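import Summits.BirchSwinnertonDyer.Rank1Residual.GaloisImage.KolyvaginStalkLevels
import Mathlib.Algebra.Module.ZMod
import Mathlib.GroupTheory.SpecificGroups.Cyclic
import Mathlib.LinearAlgebra.Projection
import Mathlib.FieldTheory.Finite.GaloisField
import HarnessLib

/-!
# The `𝔽_p`-linear functionals `t_𝔮` (transverse / singular part) and `f_𝔮` (finite part through
# the comparison map) on `H¹(K, T̄)`, and the stalks as subspaces (cell `b2b-bsdres`, team n1011,
# ROUTE-1 item R1-56 "S24(1) @ m = 1 in the kernel", row T-R1-56-S, FILE D1 of the stalk half)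

HONEST FRAMING (verbatim for the cell): research route; prove what is provable now; no claim beyond
stated classes; nothing booked; no mark / label moved.  TOOL constructions and theorems about the
Galois cohomology of a finite Galois module; no named fact, no conjecture node.  Setting = p11's
R1-16 files + `KolyvaginStalkLevels.lean` (FILE A); the `𝔽_p`-structure on `H¹(K, M)` is an
INSTANCE ARGUMENT `[Module (ZMod p) (galoisCohomology ρ 1)]` (the consumer supplies
`AddCommGroup.zmodModule` from `p · M = 0`; any such structure serves).

## What (Mazur–Rubin, JTNB 28 (2016) Def. 6.2 `loc^f_𝔩`, `loc^tr_𝔩`; Def. 8.1)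

At a finite place `𝔮` (intended: a Kolyvagin prime, where `H¹(K_𝔮, M) = H¹_ur ⊕ H¹_tr` with both
summands of order `p`): `singularTriv ρ p 𝔮 : H¹_{/ur}(K_𝔮, M) →+ ℤ/p` (an isomorphism when
`#H¹_{/ur} = p`, `singularTriv_injective`); the two functionals on `V = H¹(K, M)`
* `tFun ρ p 𝔮 = singularTriv ∘ loc^s_𝔮` (`loc^tr`; kernel = classes unramified at `𝔮`,
  `tFun_eq_zero_iff`),
* `fFun p D 𝔮 = singularTriv ∘ φ^{fs}_𝔮 ∘ pr_ur ∘ loc_𝔮`, `pr_ur` the projection onto `H¹_ur` along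
  `H¹_tr` (`loc^f`; kernel = classes transverse at `𝔮` when `φ^{fs}_𝔮` is injective on `H¹_ur`,
  `fFun_eq_zero_iff`; on classes unramified at `𝔮` it is `singularTriv ∘ (φ^{fs}_𝔮 ∘ loc_𝔮)`,
  `fFun_apply_of_mem_unramified`) — ONE trivialisation `singularTriv` for both, so that the
  finite–singular relation `loc^s_𝔮 κ_{n𝔮} = φ^{fs}_𝔮 loc_𝔮 κ_n` reads `tFun 𝔮 κ_{n𝔮} = fFun 𝔮 κ_n`;
* the stalk data as `𝔽_p`-subspaces: `Wsub 𝓕 N` (= `H¹_{𝓕^N}`), its dimension `#N + 1` at a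
  core-like level (`finrank_Wsub`), the inclusions and the hypotheses of the contraction
  (`Wsub_mono`, `tFun_apply_eq_zero_of_mem_Wsub`, `mem_Wsub_of_forall_tFun_eq_zero`), and the
  stalk `H¹_{𝓕(n)}` inside `Wsub 𝓕 N` as the common kernel of `fFun` on `n` and `tFun` on `N ∖ n`
  (`mem_selmerGroup_atLevel_iff_fFun_tFun`).
Consumer: `KolyvaginStalkExistence.lean`.

References: B. Mazur, K. Rubin, JTNB 28 (2016) 145–183 (arXiv:1312.4052) Def. 6.2, Def. 8.1,
Prop. 8.3; K. Rubin, PCMI 18 (2011) Def. 1.9.6, Prop. 1.9.5, Def. 2.2.1 (held).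
-/

noncomputable section

open scoped Classical NumberField ContRepresentation
open Function NumberField IsDedekindDomain
open Literature.NumberTheory.GaloisRepresentations Literature.NumberTheory.GaloisRepresentations.DiscreteGaloisModule
  Literature.NumberTheory.GaloisCohomology
open Summit.BirchSwinnertonDyer.Rank1Residual.GaloisImage.CoreRankZero

universe u

namespace Summit.BirchSwinnertonDyer.Rank1Residual.GaloisImage.CoreRankOne.Stalk

variable {K : Type u} [Field K] [NumberField K]
variable {M : Type u} [AddCommGroup M] [TopologicalSpace M] [DiscreteTopology M]
variable {ρ : DiscreteGaloisModule K M} (p : ℕ) [Fact p.Prime]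

/-! ## §1. Trivialising the singular quotient at a Kolyvagin prime -/

section SingularTriv

variable (ρ)

/-- `#H¹_{/ur}(K_𝔮, M) = p` when `#H¹(K_𝔮, M) = p²` and `#H¹_ur(K_𝔮, M) = p`. [folklore] -/
theorem natCard_singularQuotient_eq (q : HeightOneSpectrum (𝓞 K))
    (hU : Nat.card (unramifiedSubgroup (GaloisRep.toLocal q ρ) 1) = p)
    (hH1 : Nat.card (galoisCohomology (GaloisRep.toLocal q ρ) 1) = p ^ 2) :
    Nat.card (SingularQuotient (GaloisRep.toLocal q ρ)) = p := by
  have h := AddSubgroup.card_eq_card_quotient_mul_card_addSubgroup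
    (unramifiedSubgroup (GaloisRep.toLocal q ρ) 1)
  rw [hH1, hU, pow_two] at h
  exact (mul_right_cancel₀ (Fact.out : p.Prime).ne_zero h).symm

/-- **A trivialisation `H¹_{/ur}(K_𝔮, M) →+ ℤ/p`** of the singular quotient (an additive isomorphism
with `ZMod p` when `#H¹_{/ur}(K_𝔮, M) = p`, zero otherwise) — the generator-fixing of Kim 2026
§2.2.2 / the choice `h` of Mazur–Rubin JTNB 28 (2016) Def. 6.2, made once for both functionals.
[folklore] -/
def singularTriv (q : HeightOneSpectrum (𝓞 K)) : SingularQuotient (GaloisRep.toLocal q ρ) →+ ZMod p :=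
  if h : Nat.card (SingularQuotient (GaloisRep.toLocal q ρ)) = p then
    (addEquivOfPrimeCardEq h (Nat.card_zmod p)).toAddMonoidHom
  else 0

/-- `singularTriv` is injective when `#H¹_{/ur}(K_𝔮, M) = p`. [folklore] -/
theorem singularTriv_injective {q : HeightOneSpectrum (𝓞 K)}
    (h : Nat.card (SingularQuotient (GaloisRep.toLocal q ρ)) = p) :
    Injective (singularTriv ρ p q) := by
  rw [singularTriv, dif_pos h]
  exact (addEquivOfPrimeCardEq h (Nat.card_zmod p)).injective

end SingularTriv

/-! ## §2. The functionals `t_𝔮` and `f_𝔮` as additive maps -/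

section Homs

variable (ρ)

/-- `t_𝔮 := singularTriv ∘ loc^s_𝔮 : H¹(K, M) →+ ℤ/p` (Mazur–Rubin's `loc^tr_𝔩` followed by the
trivialisation). [folklore] -/
def tHom (q : HeightOneSpectrum (𝓞 K)) : galoisCohomology ρ 1 →+ ZMod p :=
  (singularTriv ρ p q).comp (KolyvaginDatum.singularLocalization ρ q)

/-- Unfolding `tHom`. [folklore] -/
theorem tHom_apply (q : HeightOneSpectrum (𝓞 K)) (c : galoisCohomology ρ 1) :
    tHom ρ p q c = singularTriv ρ p q (KolyvaginDatum.singularLocalization ρ q c) := rfl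

/-- `t_𝔮 c = 0 ↔ loc_𝔮 c ∈ H¹_ur(K_𝔮, M)` (when `#H¹_{/ur}(K_𝔮, M) = p`). [folklore] -/
theorem tHom_eq_zero_iff {q : HeightOneSpectrum (𝓞 K)}
    (h : Nat.card (SingularQuotient (GaloisRep.toLocal q ρ)) = p) (c : galoisCohomology ρ 1) :
    tHom ρ p q c = 0 ↔
      galoisCohomology.localization ρ (Sum.inr q) 1 c ∈ unramifiedSubgroup (GaloisRep.toLocal q ρ) 1 := by
  rw [tHom_apply, ← map_zero (singularTriv ρ p q), (singularTriv_injective ρ p h).eq_iff]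
  simp only [KolyvaginDatum.singularLocalization, AddMonoidHom.coe_comp, Function.comp_apply]
  exact singularMap_eq_zero_iff (GaloisRep.toLocal q ρ) _

variable {ρ}

/-- The projection `pr_ur : H¹(K_𝔮, M) →+ H¹(K_𝔮, M)` onto `H¹_ur` along `H¹_tr` (when the two are
complementary subgroups; zero otherwise), through the `ℤ`-submodule picture
(`Submodule.projection`). [folklore] -/
def unramifiedProj (D : KolyvaginDatum ρ) (q : HeightOneSpectrum (𝓞 K)) :
    galoisCohomology (GaloisRep.toLocal q ρ) 1 →+ galoisCohomology (GaloisRep.toLocal q ρ) 1 :=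
  if h : IsCompl (unramifiedSubgroup (GaloisRep.toLocal q ρ) 1)
      (D.transverse (Sum.inr q) : AddSubgroup (galoisCohomology (GaloisRep.toLocal q ρ) 1)) then
    (Submodule.projection
      (AddSubgroup.toIntSubmodule (unramifiedSubgroup (GaloisRep.toLocal q ρ) 1))
      (AddSubgroup.toIntSubmodule
        (D.transverse (Sum.inr q) : AddSubgroup (galoisCohomology (GaloisRep.toLocal q ρ) 1)))
      (AddSubgroup.toIntSubmodule.isCompl h)).toAddMonoidHom
  else 0

/-- Unfolding `unramifiedProj` in the complementary case. [folklore] -/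
theorem unramifiedProj_apply (D : KolyvaginDatum ρ) {q : HeightOneSpectrum (𝓞 K)}
    (h : IsCompl (unramifiedSubgroup (GaloisRep.toLocal q ρ) 1)
      (D.transverse (Sum.inr q) : AddSubgroup (galoisCohomology (GaloisRep.toLocal q ρ) 1)))
    (x : galoisCohomology (GaloisRep.toLocal q ρ) 1) :
    unramifiedProj D q x =
      Submodule.projection (AddSubgroup.toIntSubmodule (unramifiedSubgroup (GaloisRep.toLocal q ρ) 1))
        (AddSubgroup.toIntSubmodule
          (D.transverse (Sum.inr q) : AddSubgroup (galoisCohomology (GaloisRep.toLocal q ρ) 1)))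
        (AddSubgroup.toIntSubmodule.isCompl h) x := by
  rw [unramifiedProj, dif_pos h]
  rfl

/-- `pr_ur` is the identity on `H¹_ur`. [folklore] -/
theorem unramifiedProj_apply_of_mem (D : KolyvaginDatum ρ) {q : HeightOneSpectrum (𝓞 K)}
    (h : IsCompl (unramifiedSubgroup (GaloisRep.toLocal q ρ) 1)
      (D.transverse (Sum.inr q) : AddSubgroup (galoisCohomology (GaloisRep.toLocal q ρ) 1)))
    {x : galoisCohomology (GaloisRep.toLocal q ρ) 1}
    (hx : x ∈ unramifiedSubgroup (GaloisRep.toLocal q ρ) 1) : unramifiedProj D q x = x := by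
  rw [unramifiedProj_apply D h]
  exact Submodule.projection_apply_of_mem_left (AddSubgroup.toIntSubmodule.isCompl h)
    (show x ∈ AddSubgroup.toIntSubmodule (unramifiedSubgroup (GaloisRep.toLocal q ρ) 1) from hx)

/-- `pr_ur` takes values in `H¹_ur`. [folklore] -/
theorem unramifiedProj_mem (D : KolyvaginDatum ρ) {q : HeightOneSpectrum (𝓞 K)}
    (h : IsCompl (unramifiedSubgroup (GaloisRep.toLocal q ρ) 1)
      (D.transverse (Sum.inr q) : AddSubgroup (galoisCohomology (GaloisRep.toLocal q ρ) 1)))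
    (x : galoisCohomology (GaloisRep.toLocal q ρ) 1) :
    unramifiedProj D q x ∈ unramifiedSubgroup (GaloisRep.toLocal q ρ) 1 := by
  rw [unramifiedProj_apply D h]
  exact Submodule.projection_apply_mem (AddSubgroup.toIntSubmodule.isCompl h) x

/-- `pr_ur x = 0 ↔ x ∈ H¹_tr`. [folklore] -/
theorem unramifiedProj_eq_zero_iff (D : KolyvaginDatum ρ) {q : HeightOneSpectrum (𝓞 K)}
    (h : IsCompl (unramifiedSubgroup (GaloisRep.toLocal q ρ) 1)
      (D.transverse (Sum.inr q) : AddSubgroup (galoisCohomology (GaloisRep.toLocal q ρ) 1)))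
    (x : galoisCohomology (GaloisRep.toLocal q ρ) 1) :
    unramifiedProj D q x = 0 ↔ x ∈ D.transverse (Sum.inr q) := by
  rw [unramifiedProj_apply D h]
  exact Submodule.projection_apply_eq_zero_iff (AddSubgroup.toIntSubmodule.isCompl h)

/-- `f_𝔮 := singularTriv ∘ φ^{fs}_𝔮 ∘ pr_ur ∘ loc_𝔮 : H¹(K, M) →+ ℤ/p` (Mazur–Rubin's `loc^f_𝔩`
followed by the trivialisation). [folklore] -/
def fHom (D : KolyvaginDatum ρ) (q : HeightOneSpectrum (𝓞 K)) : galoisCohomology ρ 1 →+ ZMod p :=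
  (singularTriv ρ p q).comp ((D.fs q).comp ((unramifiedProj D q).comp
    (galoisCohomology.localization ρ (Sum.inr q) 1)))

/-- Unfolding `fHom`. [folklore] -/
theorem fHom_apply (D : KolyvaginDatum ρ) (q : HeightOneSpectrum (𝓞 K)) (c : galoisCohomology ρ 1) :
    fHom p D q c =
      singularTriv ρ p q (D.fs q (unramifiedProj D q (galoisCohomology.localization ρ (Sum.inr q) 1 c))) :=
  rfl

/-- On a class UNRAMIFIED at `𝔮`, `f_𝔮` is the trivialised comparison `singularTriv (φ^{fs}_𝔮 loc_𝔮 c)`.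
[folklore] -/
theorem fHom_apply_of_mem_unramified (D : KolyvaginDatum ρ) {q : HeightOneSpectrum (𝓞 K)}
    (h : IsCompl (unramifiedSubgroup (GaloisRep.toLocal q ρ) 1)
      (D.transverse (Sum.inr q) : AddSubgroup (galoisCohomology (GaloisRep.toLocal q ρ) 1)))
    {c : galoisCohomology ρ 1}
    (hc : galoisCohomology.localization ρ (Sum.inr q) 1 c ∈ unramifiedSubgroup (GaloisRep.toLocal q ρ) 1) :
    fHom p D q c = singularTriv ρ p q (D.fsLocalization q c) := by
  rw [fHom_apply, unramifiedProj_apply_of_mem D h hc]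
  rfl

/-- **`f_𝔮 c = 0 ↔ loc_𝔮 c ∈ H¹_tr(K_𝔮, M)`** when `#H¹_{/ur}(K_𝔮, M) = p`, `H¹_ur ⊕ H¹_tr = H¹(K_𝔮, M)`
and `φ^{fs}_𝔮` is injective on `H¹_ur` (admissibility). [folklore] -/
theorem fHom_eq_zero_iff (D : KolyvaginDatum ρ) {q : HeightOneSpectrum (𝓞 K)}
    (hSQ : Nat.card (SingularQuotient (GaloisRep.toLocal q ρ)) = p)
    (h : IsCompl (unramifiedSubgroup (GaloisRep.toLocal q ρ) 1)
      (D.transverse (Sum.inr q) : AddSubgroup (galoisCohomology (GaloisRep.toLocal q ρ) 1)))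
    (hinj : Injective fun x : unramifiedSubgroup (GaloisRep.toLocal q ρ) 1 =>
      D.fs q (x : galoisCohomology _ 1))
    (c : galoisCohomology ρ 1) :
    fHom p D q c = 0 ↔ galoisCohomology.localization ρ (Sum.inr q) 1 c ∈ D.transverse (Sum.inr q) := by
  rw [fHom_apply, ← map_zero (singularTriv ρ p q), (singularTriv_injective ρ p hSQ).eq_iff]
  constructor
  · intro h0
    have hmem := unramifiedProj_mem D h (galoisCohomology.localization ρ (Sum.inr q) 1 c)
    have h1 : (⟨_, hmem⟩ : unramifiedSubgroup (GaloisRep.toLocal q ρ) 1) = ⟨0, zero_mem _⟩ :=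
      hinj (by simpa using h0)
    exact (unramifiedProj_eq_zero_iff D h _).mp (congrArg Subtype.val h1)
  · intro h0
    rw [(unramifiedProj_eq_zero_iff D h _).mpr h0, map_zero]

end Homs

/-! ## §3. As `𝔽_p`-linear functionals; the stalk data as `𝔽_p`-subspaces -/

section Linear

variable (ρ) [Module (ZMod p) (galoisCohomology ρ 1)]

/-- `t_𝔮` as an `𝔽_p`-linear functional on `V = H¹(K, M)`. [folklore] -/
def tFun (q : HeightOneSpectrum (𝓞 K)) : Module.Dual (ZMod p) (galoisCohomology ρ 1) :=
  (tHom ρ p q).toZModLinearMap p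

/-- Unfolding `tFun`. [folklore] -/
@[simp] theorem tFun_apply (q : HeightOneSpectrum (𝓞 K)) (c : galoisCohomology ρ 1) :
    tFun ρ p q c = tHom ρ p q c := rfl

variable {ρ}

/-- `f_𝔮` as an `𝔽_p`-linear functional on `V = H¹(K, M)`. [folklore] -/
def fFun (D : KolyvaginDatum ρ) (q : HeightOneSpectrum (𝓞 K)) : Module.Dual (ZMod p) (galoisCohomology ρ 1) :=
  (fHom p D q).toZModLinearMap p

/-- Unfolding `fFun`. [folklore] -/
@[simp] theorem fFun_apply (D : KolyvaginDatum ρ) (q : HeightOneSpectrum (𝓞 K))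
    (c : galoisCohomology ρ 1) : fFun p D q c = fHom p D q c := rfl

/-- **The relaxed Selmer group `W(N) = H¹_{𝓕^N}(K, M)` as an `𝔽_p`-subspace of `H¹(K, M)`.**
[folklore] -/
def Wsub (𝓕 : SelmerStructure ρ) (N : Finset (HeightOneSpectrum (𝓞 K))) :
    Submodule (ZMod p) (galoisCohomology ρ 1) :=
  AddSubgroup.toZModSubmodule p (𝓕.relaxedAt N).selmerGroup

/-- Membership in `Wsub`. [folklore] -/
@[simp] theorem mem_Wsub_iff (𝓕 : SelmerStructure ρ) (N : Finset (HeightOneSpectrum (𝓞 K)))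
    (x : galoisCohomology ρ 1) : x ∈ Wsub p 𝓕 N ↔ x ∈ (𝓕.relaxedAt N).selmerGroup := Iff.rfl

/-- `Wsub` is monotone in the level. [folklore] -/
theorem Wsub_mono (𝓕 : SelmerStructure ρ) {N N' : Finset (HeightOneSpectrum (𝓞 K))} (h : N ⊆ N') :
    Wsub p 𝓕 N ≤ Wsub p 𝓕 N' :=
  fun _ hx => (mem_Wsub_iff p 𝓕 N' _).mpr (selmerGroup_mono (relaxedAt_mono 𝓕 h) hx)

/-- `Wsub 𝓕 N` is finite when `H¹_𝓕(K, M)` is. [folklore] -/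
instance finite_Wsub [Finite M] (𝓕 : SelmerStructure ρ) [hfin : Finite 𝓕.selmerGroup]
    (N : Finset (HeightOneSpectrum (𝓞 K))) : Finite (Wsub p 𝓕 N) :=
  finite_selmerGroup_relaxedAt 𝓕 hfin N

/-- **`dim_{𝔽_p} W(N) = #N + 1`** when `#W(N) = p^{#N+1}` (a core-like level at core rank one,
`natCard_selmerGroup_relaxedAt_eq_pow_mul`). [folklore] -/
theorem finrank_Wsub [Finite M] (𝓕 : SelmerStructure ρ) [Finite 𝓕.selmerGroup]
    {N : Finset (HeightOneSpectrum (𝓞 K))}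
    (hN : Nat.card (𝓕.relaxedAt N).selmerGroup = p ^ (N.card + 1)) :
    Module.finrank (ZMod p) (Wsub p 𝓕 N) = N.card + 1 := by
  have h := FiniteField.pow_finrank_eq_natCard p (Wsub p 𝓕 N)
  rw [show Nat.card (Wsub p 𝓕 N) = Nat.card (𝓕.relaxedAt N).selmerGroup from rfl, hN] at h
  exact Nat.pow_right_injective (Fact.out : p.Prime).two_le h

/-- `Fintype.card (Option N) = dim W(N)` at such a level — the index-set condition of the volume
forms. [folklore] -/
theorem card_option_eq_finrank_Wsub [Finite M] (𝓕 : SelmerStructure ρ) [Finite 𝓕.selmerGroup]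
    {N : Finset (HeightOneSpectrum (𝓞 K))}
    (hN : Nat.card (𝓕.relaxedAt N).selmerGroup = p ^ (N.card + 1)) :
    Fintype.card (Option ↥N) = Module.finrank (ZMod p) (Wsub p 𝓕 N) := by
  rw [finrank_Wsub p 𝓕 hN, Fintype.card_option, Fintype.card_coe]

/-- A class of `W(N)` is killed by `t_𝔮` at every Kolyvagin prime `𝔮 ∉ N` (it is unramified
there). [folklore] -/
theorem tFun_apply_eq_zero_of_mem_Wsub {S : Finset (Place K)} {𝓕 : SelmerStructure ρ}
    (h𝓕 : 𝓕.IsUnramifiedOutside S) {D : KolyvaginDatum ρ} (hPS : ∀ q ∈ D.primes, (Sum.inr q : Place K) ∉ S)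
    (hSQ : ∀ q ∈ D.primes, Nat.card (SingularQuotient (GaloisRep.toLocal q ρ)) = p)
    {N : Finset (HeightOneSpectrum (𝓞 K))} {q : HeightOneSpectrum (𝓞 K)} (hq : q ∈ D.primes)
    (hqN : q ∉ N) {w : galoisCohomology ρ 1} (hw : w ∈ Wsub p 𝓕 N) : tFun ρ p q w = 0 := by
  rw [tFun_apply, tHom_eq_zero_iff ρ p (hSQ q hq)]
  have := (SelmerStructure.mem_selmerGroup_iff _ _).mp ((mem_Wsub_iff p 𝓕 N w).mp hw) (Sum.inr q)
  rwa [relaxedAt_inr_of_not_mem 𝓕 hqN, h𝓕.2 q (hPS q hq)] at this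

/-- A class of `W(N′)` killed by `t_𝔮` at every `𝔮 ∈ N′ ∖ N` lies in `W(N)` (`N ⊆ N′` levels): the
frozen transverse functionals cut `W(N)` out of `W(N′)`. [folklore] -/
theorem mem_Wsub_of_forall_tFun_eq_zero {S : Finset (Place K)} {𝓕 : SelmerStructure ρ}
    (h𝓕 : 𝓕.IsUnramifiedOutside S) {D : KolyvaginDatum ρ} (hPS : ∀ q ∈ D.primes, (Sum.inr q : Place K) ∉ S)
    (hSQ : ∀ q ∈ D.primes, Nat.card (SingularQuotient (GaloisRep.toLocal q ρ)) = p)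
    {N N' : Finset (HeightOneSpectrum (𝓞 K))} (hN' : D.IsLevel N')
    {v : galoisCohomology ρ 1} (hv : v ∈ Wsub p 𝓕 N')
    (h : ∀ q ∈ N', q ∉ N → tFun ρ p q v = 0) : v ∈ Wsub p 𝓕 N := by
  rw [mem_Wsub_iff, SelmerStructure.mem_selmerGroup_iff] at hv ⊢
  intro w
  cases w with
  | inl w => rw [relaxedAt_inl]; have := hv (Sum.inl w); rwa [relaxedAt_inl] at this
  | inr q =>
    by_cases hqN : q ∈ N
    · rw [relaxedAt_inr_of_mem 𝓕 hqN]; exact AddSubgroup.mem_top _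
    · rw [relaxedAt_inr_of_not_mem 𝓕 hqN]
      by_cases hqN' : q ∈ N'
      · have hq : q ∈ D.primes := hN' hqN'
        rw [h𝓕.2 q (hPS q hq)]
        exact (tHom_eq_zero_iff ρ p (hSQ q hq) v).mp (h q hqN' hqN)
      · have := hv (Sum.inr q); rwa [relaxedAt_inr_of_not_mem 𝓕 hqN'] at this

/-- **The stalk `H¹_{𝓕(n)}(K, M)` inside `W(N)` as a common kernel** (`n ⊆ N` levels): a class of
`W(N)` lies in `H¹_{𝓕(n)}` iff `f_𝔮` kills it for `𝔮 ∈ n` and `t_𝔮` kills it for `𝔮 ∈ N ∖ n`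
(Mazur–Rubin JTNB 28 (2016) (gi2) / Def. 8.1). [folklore] -/
theorem mem_selmerGroup_atLevel_iff_fFun_tFun {S : Finset (Place K)} {𝓕 : SelmerStructure ρ}
    (h𝓕 : 𝓕.IsUnramifiedOutside S) {D : KolyvaginDatum ρ} (hPS : ∀ q ∈ D.primes, (Sum.inr q : Place K) ∉ S)
    (hSQ : ∀ q ∈ D.primes, Nat.card (SingularQuotient (GaloisRep.toLocal q ρ)) = p)
    (hc : ∀ q ∈ D.primes, IsCompl (unramifiedSubgroup (GaloisRep.toLocal q ρ) 1)
      (D.transverse (Sum.inr q) : AddSubgroup (galoisCohomology (GaloisRep.toLocal q ρ) 1)))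
    (hadm : D.IsAdmissible)
    {n N : Finset (HeightOneSpectrum (𝓞 K))} (hnN : n ⊆ N) (hN : D.IsLevel N)
    {x : galoisCohomology ρ 1} (hx : x ∈ Wsub p 𝓕 N) :
    x ∈ (D.atLevel 𝓕 n).selmerGroup ↔
      (∀ q ∈ n, fFun p D q x = 0) ∧ ∀ q ∈ N, q ∉ n → tFun ρ p q x = 0 := by
  rw [mem_selmerGroup_atLevel_iff_of_subset 𝓕 D h𝓕 (fun q hq => hPS q (hN hq))
    ((mem_Wsub_iff p 𝓕 N x).mp hx)]
  refine and_congr (forall₂_congr fun q hq => ?_) (forall₂_congr fun q hq => imp_congr_right fun _ => ?_)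
  · have hqP : q ∈ D.primes := hN (hnN hq)
    rw [fFun_apply, fHom_eq_zero_iff p D (hSQ q hqP) (hc q hqP) (hadm q hqP).1]
  · rw [tFun_apply, tHom_eq_zero_iff ρ p (hSQ q (hN hq))]

end Linear

end Summit.BirchSwinnertonDyer.Rank1Residual.GaloisImage.CoreRankOne.Stalk

end
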